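/-
Origin: expansion seat `planner-pub-hodgecm-pohl-g15-0`, handover #2 2026-08-18T16:19:39Z (md5 03e073000e92d8460dce5d6fb7ebd129, 211 l.; RUN-32 CANDIDATE ROW, ON REQUEST ONLY — TREE-SHAPE SPLIT (≤400 l.) of the pohl lineage, source lines verbatim; REPLACES HodgeCM/Proofs/Pohlmann/WeightLines.lean in place (module name kept ⇒ no importer edits); lands AFTER WeightLinesMonomial; rewrites import Pohl15.WeightLinesMonomial -> HodgeCM.Proofs.Pohlmann.WeightLinesMonom (`HOME/pub-hodgecm-pohl-g15/lean/Pohl15/WeightLines.lean`, md5 03e07300, 211 lines);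
landed by the packager successor (mc-unitary-1-g3, gen-8 kit) in gate run 32 REPLACES the earlier landed copy of `HodgeCM/Proofs/Pohlmann/WeightLines.lean` (import ^import Pohl15\.WeightLinesMonomial[ \t]*$→import HodgeCM.Proofs.Pohlmann.WeightLinesMonomial ×1).
-/
/-
Copyright: pub-hodgecm formalisation cell (harness21, 2026). New file (not vendored).
Origin: HOME/pub-hodgecm-pohl-g15/lean/Pohl15/WeightLines.lean — session planner-pub-hodgecm-pohl-g15-0 (unit pub-hodgecm-pohl-g15),
EXPANSION part (b) `PohlmannSpan`, generation 15: TREE-SHAPE STAGING under the 400-line rule of lean/CONVENTIONS.md §2 — part 2/2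
of the split of `HodgeCM/Proofs/Pohlmann/WeightLines.lean` (pohl-g3, gate run 22; 420 l., md5 93529a8e071a): source lines 274–420 VERBATIM; the module docstring below is the source's, with one `Layout` sentence appended.
Intended final place: `HodgeCM/Proofs/Pohlmann/WeightLines.lean` (module `HodgeCM.Proofs.Pohlmann.WeightLines`); WIP import `Pohl15.WeightLinesMonomial` → `HodgeCM.Proofs.Pohlmann.WeightLinesMonomial` on landing.  The LAST part keeps the old module name, so no importer changes.
-/
import Summits.HodgeConjecture.HodgeCM.Proofs.Pohlmann.WeightLinesMonomial

/-!
# Hodge-weight spaces are lines: the literal "basis" form of Pohlmann's theorem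

Gao–Ullmo, *J. Inst. Math. Jussieu* **25** (2025) 215–249 (= arXiv:2411.12249), Thm 3.1 "(Pohlmann)", p. 9
ll. 32–39: "For each `p ≥ 0`, the vector space `B^p(A) ⊗ ℂ` has a basis consisting of `[P]` for those ordered sets
`P ∈ 𝒫(S)` with `|P| = 2p` such that `|σP ∩ Φ| = |σP ∩ Φ̄|` for all `σ ∈ G`.  In particular `dim_ℚ B^p(A)` is the
number of ordered `P ∈ 𝒫(S)` with `|P| = 2p` satisfying (3.2)."

`HodgeCM.Universe.PohlmannBasis` (`PohlmannEq.lean`) is the statement with Pohlmann's lines `ℂ[P]` replaced by the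
weight SPACES `V_S = U.weightSpace F Θ S (2p)` of the product `A′ = ∏_j A_{(F,Θ_j)}`:
`B^p(A′) ⊗ ℂ = ⨁_{S Hodge weight} V_S`.  This file closes the remaining gap to the printed wording, in the abstract
`Universe` and from the same inputs (`ModelAxioms` + N1 `Fact_cupExterior`; N2–N4 only through `PohlmannBasis`):

* `finrank_weightSpace` — for `m ≥ 1`, **`dim_ℂ V_S = 1` if `Σ_j |S_j| = m` and `V_S = 0` otherwise**
  (`U.weightSpace F Θ S m`); in particular every Hodge weight `S` of `B^p`, `p ≥ 1`, has a weight LINE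
  (`finrank_weightSpace_of_isHodgeWeight`), and (E1a) `Fact_weightLine` of `StubTree/Qw8Twist.lean` holds in positive
  degree (`finrank_weightSpace_le_one`, `weightSpace_eq_span_of_ne_zero_of_pos`).
* `exists_basis_hodgeClassesOf` — **`B^p(A′) ⊗ ℂ` has a basis indexed by the Hodge weights `S` and consisting of
  weight vectors of weight `S`** (`p ≥ 1`), i.e. Thm 3.1 verbatim with `[P] ↦` "a generator of `V_S`".
* `finrank_hodgeClassesOf` — **`dim_ℚ B^p(A′) = #{S : IsHodgeWeight Θ p S}`** (`p ≥ 1`), the "In particular" clause;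
* `PohlmannTheorem31` / `pohlmannTheorem31_of_facts` — the two sentences of Thm 3.1 bundled as one `Prop`, proved from
  `ModelAxioms` + N1–N4.

(For `p = 0`, `PohlmannBasis` reads `B⁰ ⊗ ℂ = V_{(∅)_j} = H⁰(A′, ℂ)`; that this is a line is connectedness of `A′`,
which no recorded fact of the package asserts — N3 `Fact_pull_H0` only says `End` acts trivially on `H⁰` — so the
degree-zero case is not claimed.)

## Proof (a dimension count; no new input)
Fix the eigenbases `x_j = (x_{j,τ})_τ` of the `H¹(A_{Θ_j}, ℂ)` (`exists_eigenbasis`, M11/M22) and the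
eigen-monomials `fmono x k p = ∪_i pr_{j_i}^* x_{j_i,τ_i}` of `WeightSpan.lean`.  Let `N_T` be the span of the
monomials with distinct entries and weight `T` (`monoSpan`).  From gen 2: `N_T ⊆ V_T`, `Σ_T N_T = H^{k+1}(A′, ℂ)`
(N1 + Künneth) and the `V_T` are independent; hence `V_T = N_T` (`weightSpace_eq_monoSpan`).  Two injective
index maps with the same weight differ by a permutation of the `k + 1` slots, and permuting slots changes `fmono`
by a sign (N1: `cupPowC_swap`), so `dim N_T ≤ 1`, and `N_T = 0` unless `Σ_j |T_j| = k + 1`.  On the other hand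
`dim_ℂ H^{k+1}(A′, ℂ) = dim_ℚ ⋀^{k+1} H¹(A′, ℚ) = C(d, k+1)` with `d = dim H¹(A′, ℚ) = (n+1)[F:ℚ]` (N1, Mathlib's
`exteriorPower.finrank_eq`, M21 `kunneth1`, M22 `H1_rank`), and the number of `T` with `Σ_j |T_j| = k + 1` is at
most `C((n+1)[F:ℚ], k+1)` (inject `T ↦ Σ_j T_j ⊆ ⊔_j Hom(F, ℂ)`).  Since `H^{k+1} = ⨁_T V_T`, the termwise bounds
are equalities.  The basis of `B^p ⊗ ℂ` is then read off `PohlmannBasis` and `iSupIndep_weightSpace_hodge`.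

Layout (2026-08-18, tree 400-line rule): the dimension counts and the monomial spans `N_T` (former first half of this file) are now `WeightLinesMonomial.lean`, imported here; all statements verbatim.
-/

noncomputable section

open scoped TensorProduct NumberField

namespace HodgeCM

open Literature.AlgebraicGeometry.Motives (CMType)
open HodgeCM.Pohlmann

namespace Universe

variable {U : Universe}

/-! ## The weight spaces are lines -/

section Lines

variable {F : CMField} {n : ℕ} {Θ : Fin (n + 1) → CMType F}

/-- **Weight spaces in positive degree are lines**: `dim_ℂ V_S = 1` if `Σ_j |S_j| = k + 1`, and `V_S = 0` otherwise
(`ModelAxioms` + N1). -/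
theorem finrank_weightSpace_succ (M : U.ModelAxioms) (hN1 : U.Fact_cupExterior) (k : ℕ)
    (S : Fin (n + 1) → Finset ((F : Type) →+* ℂ)) :
    Module.finrank ℂ (U.weightSpace F Θ S (k + 1)) = if (∑ j, (S j).card) = k + 1 then 1 else 0 := by
  classical
  obtain ⟨β, -, hβ⟩ := exists_integral_injective_eval F
  choose x hx _hx0 hsp using fun j => exists_eigenbasis M F (Θ j) β hβ
  have hE := hN1 F n Θ k
  -- termwise bound `dim V_T ≤ c_T`
  let c : (Fin (n + 1) → Finset ((F : Type) →+* ℂ)) → ℕ := fun T => if (∑ j, (T j).card) = k + 1 then 1 else 0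
  have hle : ∀ T, Module.finrank ℂ (U.weightSpace F Θ T (k + 1)) ≤ c T := by
    intro T
    rw [weightSpace_eq_monoSpan x M hx hE hsp T]
    by_cases hT : (∑ j, (T j).card) = k + 1
    · simp only [c, hT, if_true]
      exact finrank_monoSpan_le_one x hE T
    · simp only [c, hT, if_false]
      rw [monoSpan_eq_bot_of_sum_card_ne x hT, finrank_bot]
  -- total dimension `Σ_T dim V_T = dim H^{k+1}(A′, ℂ) = C((n+1)[F:ℚ], k+1)`
  have htot : ∑ T, Module.finrank ℂ (U.weightSpace F Θ T (k + 1)) =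
      ((n + 1) * Module.finrank ℚ F).choose (k + 1) := by
    rw [← finrank_iSup_eq_sum _ (iSupIndep_weightSpace M (k + 1)), iSup_weightSpace_succ M hN1 k, finrank_top,
      finrank_cohC_succ hE, finrank_coh_one_cmProd M F Θ]
  -- and there are at most that many weights of size `k + 1`
  have hc : ∑ T, c T ≤ ((n + 1) * Module.finrank ℚ F).choose (k + 1) := by
    rw [← Finset.card_filter, ← NumberField.Embeddings.card (F : Type) ℂ]
    exact card_filter_sum_card_eq_le ((F : Type) →+* ℂ) n (k + 1)
  have heq : ∑ T, Module.finrank ℂ (U.weightSpace F Θ T (k + 1)) = ∑ T, c T :=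
    le_antisymm (Finset.sum_le_sum fun T _ => hle T) (hc.trans htot.symm.le)
  exact (Finset.sum_eq_sum_iff_of_le fun T _ => hle T).mp heq S (Finset.mem_univ S)

/-- The same in every positive degree `m`. -/
theorem finrank_weightSpace (M : U.ModelAxioms) (hN1 : U.Fact_cupExterior) {m : ℕ} (hm : 0 < m)
    (S : Fin (n + 1) → Finset ((F : Type) →+* ℂ)) :
    Module.finrank ℂ (U.weightSpace F Θ S m) = if (∑ j, (S j).card) = m then 1 else 0 := by
  cases m with
  | zero => exact absurd hm (lt_irrefl 0)
  | succ k => exact finrank_weightSpace_succ M hN1 k S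

/-- Weights of the wrong size have no weight vectors (positive degree). -/
theorem weightSpace_eq_bot_of_sum_card_ne (M : U.ModelAxioms) (hN1 : U.Fact_cupExterior) {m : ℕ} (hm : 0 < m)
    {S : Fin (n + 1) → Finset ((F : Type) →+* ℂ)} (hS : (∑ j, (S j).card) ≠ m) : U.weightSpace F Θ S m = ⊥ := by
  rw [← Submodule.finrank_eq_zero, finrank_weightSpace M hN1 hm S, if_neg hS]

/-- `dim_ℂ V_S ≤ 1` in every positive degree — the positive-degree part of `StubTree/Qw8Twist.lean`'s candidate (E1a)
`Fact_weightLine`, now a theorem of `ModelAxioms` + N1.  (Degree `0` would need `dim H⁰(A′) = 1`, i.e. connectedness,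
which no recorded fact asserts.) -/
theorem finrank_weightSpace_le_one (M : U.ModelAxioms) (hN1 : U.Fact_cupExterior) {m : ℕ} (hm : 0 < m)
    (S : Fin (n + 1) → Finset ((F : Type) →+* ℂ)) : Module.finrank ℂ (U.weightSpace F Θ S m) ≤ 1 := by
  rw [finrank_weightSpace M hN1 hm S]
  split_ifs <;> omega

/-- In positive degree a nonzero weight vector spans its weight space (`x = c · e_S` in the model); cf.
`Universe.weightSpace_eq_span_of_ne_zero` (Qw8Twist.lean), which assumes (E1a) in all degrees. -/
theorem weightSpace_eq_span_of_ne_zero_of_pos (M : U.ModelAxioms) (hN1 : U.Fact_cupExterior) {m : ℕ} (hm : 0 < m)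
    (S : Fin (n + 1) → Finset ((F : Type) →+* ℂ)) {x : U.CohC (U.cmProd F Θ) m} (hx : U.IsWeightVector F Θ S m x)
    (hx0 : x ≠ 0) : U.weightSpace F Θ S m = ℂ ∙ x :=
  (Submodule.eq_of_le_of_finrank_le
    ((Submodule.span_singleton_le_iff_mem _ _).mpr ((U.mem_weightSpace_iff F Θ S m x).2 hx))
    (by rw [finrank_span_singleton hx0]; exact finrank_weightSpace_le_one M hN1 hm S)).symm

/-- **Every Hodge weight of `B^p(A′)`, `p ≥ 1`, carries a weight LINE.** -/
theorem finrank_weightSpace_of_isHodgeWeight (M : U.ModelAxioms) (hN1 : U.Fact_cupExterior) {p : ℕ} (hp : 0 < p)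
    {S : Fin (n + 1) → Finset ((F : Type) →+* ℂ)} (hS : IsHodgeWeight Θ p S) :
    Module.finrank ℂ (U.weightSpace F Θ S (2 * p)) = 1 := by
  rw [finrank_weightSpace M hN1 (by omega) S, if_pos hS.1]

/-! ## Pohlmann's theorem, literal form: a basis of `B^p(A′) ⊗ ℂ` of Hodge-weight vectors, and `dim_ℚ B^p(A′)` -/

/-- **Gao–Ullmo Thm 3.1 (Pohlmann), basis form**, for `A′ = ∏_j A_{(F,Θ_j)}` and `p ≥ 1`: `B^p(A′) ⊗ ℂ` has a basis
indexed by the Hodge weights `S` (`|S| = 2p` and `|P·S ∩ Θ| = |P·S ∖ Θ|` for all Galois translates `P`) whose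
`S`-th vector is a weight vector of weight `S` (a generator of the line `V_S`).  Inputs: `ModelAxioms` + N1–N4. -/
theorem exists_basis_hodgeClassesOf (M : U.ModelAxioms) (hN1 : U.Fact_cupExterior) (hN2 : U.Fact_cup_hodge)
    (hN3 : U.Fact_pull_H0) (hN4 : U.Fact_hodge_F0) [IsGalois ℚ F] {p : ℕ} (hp : 0 < p) :
    ∃ b : Module.Basis {S : Fin (n + 1) → Finset ((F : Type) →+* ℂ) // IsHodgeWeight Θ p S} ℂ
        ↥((U.hodgeClassesOf (U.cmProd F Θ) p).baseChange ℂ),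
      ∀ S, ((b S : ↥((U.hodgeClassesOf (U.cmProd F Θ) p).baseChange ℂ)) : U.CohC (U.cmProd F Θ) (2 * p)) ∈
        U.weightSpace F Θ S.1 (2 * p) := by
  classical
  have h1 : ∀ S : {S : Fin (n + 1) → Finset ((F : Type) →+* ℂ) // IsHodgeWeight Θ p S},
      Module.finrank ℂ (U.weightSpace F Θ S.1 (2 * p)) = 1 :=
    fun S => finrank_weightSpace_of_isHodgeWeight M hN1 hp S.2
  have hne : ∀ S : {S : Fin (n + 1) → Finset ((F : Type) →+* ℂ) // IsHodgeWeight Θ p S},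
      ∃ v ∈ U.weightSpace F Θ S.1 (2 * p), v ≠ 0 := fun S => by
    apply Submodule.exists_mem_ne_zero_of_ne_bot
    intro h
    have h' := h1 S
    rw [h, finrank_bot] at h'
    exact zero_ne_one h'
  choose v hv hv0 using hne
  have hli : LinearIndependent ℂ v :=
    iSupIndep.linearIndependent _ (iSupIndep_weightSpace_hodge M p) hv hv0
  have hline : ∀ S, U.weightSpace F Θ S.1 (2 * p) = ℂ ∙ v S := fun S =>
    (Submodule.eq_of_le_of_finrank_le ((Submodule.span_singleton_le_iff_mem _ _).mpr (hv S))
      (by rw [h1 S, finrank_span_singleton (hv0 S)])).symm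
  have hspan : Submodule.span ℂ (Set.range v) = (U.hodgeClassesOf (U.cmProd F Θ) p).baseChange ℂ := by
    rw [pohlmannBasis_of_facts M hN1 hN2 hN3 hN4 F ‹_› n Θ p, iSup_subtype', Submodule.span_range_eq_iSup]
    exact iSup_congr fun S => (hline S).symm
  refine ⟨(Module.Basis.span hli).map (LinearEquiv.ofEq _ _ hspan), fun S => ?_⟩
  rw [Module.Basis.map_apply, LinearEquiv.coe_ofEq_apply, Module.Basis.span_apply]
  exact hv S

/-- **"In particular `dim_ℚ B^p(A)` is the number of" Hodge weights** (Gao–Ullmo Thm 3.1, second sentence), `p ≥ 1`. -/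
theorem finrank_hodgeClassesOf (M : U.ModelAxioms) (hN1 : U.Fact_cupExterior) (hN2 : U.Fact_cup_hodge)
    (hN3 : U.Fact_pull_H0) (hN4 : U.Fact_hodge_F0) [IsGalois ℚ F] {p : ℕ} (hp : 0 < p) :
    Module.finrank ℚ (U.hodgeClassesOf (U.cmProd F Θ) p) =
      Nat.card {S : Fin (n + 1) → Finset ((F : Type) →+* ℂ) // IsHodgeWeight Θ p S} := by
  obtain ⟨b, -⟩ := exists_basis_hodgeClassesOf (Θ := Θ) M hN1 hN2 hN3 hN4 hp
  rw [← Module.finrank_eq_nat_card_basis b,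
    ← (Submodule.toBaseChange.toLinearEquiv ℂ (U.hodgeClassesOf (U.cmProd F Θ) p)).finrank_eq,
    Module.finrank_baseChange]

/-- **Gao–Ullmo Thm 3.1 "(Pohlmann)", both sentences, in the product form and for `p ≥ 1`**: for a Galois CM field
`F`, `A′ = ∏_{j ≤ n} A_{(F,Θ_j)}` and `p ≥ 1`, (i) `B^p(A′) ⊗ ℂ` has a basis indexed by the Hodge weights `S`
(`Σ_j |S_j| = 2p` and `Σ_j |P·S_j ∩ Θ_j| = p` for every Galois translate `P`, `IsHodgeWeight`) whose `S`-th member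
is a weight vector of weight `S`, and (ii) `dim_ℚ B^p(A′)` is the number of Hodge weights.  (The case `p = 0` is
`B⁰ ⊗ ℂ = H⁰(A′, ℂ)`, contained in `PohlmannBasis`.) -/
def PohlmannTheorem31 (U : Universe) : Prop :=
  ∀ (F : CMField), IsGalois ℚ F → ∀ (n : ℕ) (Θ : Fin (n + 1) → CMType F) (p : ℕ), 0 < p →
    (∃ b : Module.Basis {S : Fin (n + 1) → Finset ((F : Type) →+* ℂ) // IsHodgeWeight Θ p S} ℂ
        ↥((U.hodgeClassesOf (U.cmProd F Θ) p).baseChange ℂ),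
      ∀ S, ((b S : ↥((U.hodgeClassesOf (U.cmProd F Θ) p).baseChange ℂ)) : U.CohC (U.cmProd F Θ) (2 * p)) ∈
        U.weightSpace F Θ S.1 (2 * p)) ∧
    Module.finrank ℚ (U.hodgeClassesOf (U.cmProd F Θ) p) =
      Nat.card {S : Fin (n + 1) → Finset ((F : Type) →+* ℂ) // IsHodgeWeight Θ p S}

/-- **Pohlmann's theorem (Gao–Ullmo Thm 3.1, basis + dimension form) from the model axioms and N1–N4.** -/
theorem pohlmannTheorem31_of_facts (M : U.ModelAxioms) (hN1 : U.Fact_cupExterior) (hN2 : U.Fact_cup_hodge)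
    (hN3 : U.Fact_pull_H0) (hN4 : U.Fact_hodge_F0) : U.PohlmannTheorem31 := fun F hG n Θ p hp =>
  haveI := hG
  ⟨exists_basis_hodgeClassesOf (F := F) (n := n) (Θ := Θ) (p := p) M hN1 hN2 hN3 hN4 hp,
    finrank_hodgeClassesOf (F := F) (n := n) (Θ := Θ) (p := p) M hN1 hN2 hN3 hN4 hp⟩

end Lines

end Universe

end HodgeCM

end
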